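import Literature.Barriers.ValiantsHypothesis.MonotoneGapPermanentUpper
import Literature.Computability.AlgebraicComplexity.HamiltonianCycleVNP
import Mathlib.Data.Fin.Tuple.Basic
import HarnessLib

/-!
# Jerrum–Snir's upper bound for the monotone complexity of the Hamiltonian circuit polynomial
# (J. ACM 29 (1982), §4.4, pp. 890–891): the Hamiltonian-path dynamic programme

The upper-bound half of §4.4 of

* [JerrumSnir1982] M. Jerrum, M. Snir, *Some exact complexity results for straight-line
  computations over semirings*, J. ACM 29 (1982) 874–897, pp. 890–891:

"Again this bound is valid for `R`, `M`, and `M⁺`, and is attainable. Let `p_{I,i,j}` ... be the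
polynomial corresponding to all Hamiltonian paths in `K_n` which start at node `i`, end at node
`j`, and pass through all the nodes in `I`. We may form `p_{I,i,j}` recursively ...
`p_{I,i,j} = Σ_l p_{I∖{i},l,j} x_{il}`. Generating all `p_{I,i,j}` (`|I| = r`) given `p_{I',i',j'}`
(`|I'| = r - 1`) can be achieved using `r (n-1) C(n-2, r)` multiplications, so we can compute
`p_{{2,…,n}∖j, j}` ... in `(n-1)(n-2) 2^{(n-3)}` multiplications. Now
`HC_{n×n} = Σ_{j=2}^{n} p_{{2,…,n}∖j,j} x_{j1}`, so it can be computed in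
`(n-1)(n-2)2^{(n-3)} + (n-1)` multiplications."

We build this dynamic programme as an explicit monotone computation (`IsMonotoneComputation`,
`MonotoneGap.lean`: a plain fan-in-two `ArithCircuit` over `ℝ≥0`) of the tree's
`hcPoly (Fin n) ℝ≥0 = Σ_{σ an n-cycle} Π_i X_{σ i, i}` and count its product gates, reusing the
gate-emission infrastructure of the permanent's Laplace expansion (`JerrumSnir.emitSumProd`,
`JerrumSnir.OpOK`, `MonotoneGapPermanentUpper.lean`). The path polynomials are rendered through
vertex SEQUENCES, so that the top identity is the tree's
`hamiltonianCycleSum_eq_sum_orderings` (`HamiltonianCycleVNP.lean`: `HC` as a sum over the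
orderings of the vertices starting at `0`):

* `JerrumSnir.pathMon r v = Π_{t<r} X_{v(t+1), v(t)}` — the monomial of the path
  `v 0 → v 1 → ⋯ → v r` (in the tree's convention `X (a, b)` is the arc `b → a`);
  `JerrumSnir.pathSeqs r S j` — the injective sequences `v : Fin (r+1) → Fin n` with `v 0 = 0`,
  vertex set `{0} ∪ S` and `v r = j`; `JerrumSnir.seqPathPoly r S j = Σ_{v ∈ pathSeqs r S j} pathMon r v`
  — JS's path polynomial (all Hamiltonian paths of `{0} ∪ S` from `0` to `j`);
* `JerrumSnir.seqPathPoly_one` (`p = x`: a single arc), `JerrumSnir.seqPathPoly_succ` — **the dynamic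
  programming recurrence** `seqPathPoly (r+1) S j = Σ_{l ∈ S∖j} X_{j,l} · seqPathPoly r (S∖j) l`
  (peel off the last arc: `Fin.init` / `Fin.snoc`);
* `JerrumSnir.hcPoly_eq_sum_seqPathPoly` — **the top identity**
  `HC_n = Σ_{j ≠ 0} X_{0,j} · seqPathPoly (n-1) (univ∖0) j` (close the path by the arc `j → 0`), from
  `hamiltonianCycleSum_eq_sum_orderings`;
* `JerrumSnir.pathCircuit m` — the circuit for `n = m + 2`, processing the pairs `(S, j)`,
  `j ∈ S ⊆ univ∖0`, level by level in `|S|` (`processKey`, `processKeys`, `buildLevels`, with the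
  invariant `KGood` and the specifications `processKey_spec`, `processKeys_spec`,
  `buildLevels_spec`, exactly as for the permanent), and `pathCircuit_spec`: it is a monotone
  computation of `HC_{m+2}` with exactly `Σ_{s=2}^{m+1} s(s-1)C(m+1,s) + (m+1) = (m+1)(m 2^{m-1} + 1)`
  product gates (`sum_Ico_choose_mul_mul_sub_one`); `exists_isMonotoneComputation_hcPoly_of_two_le` restates this
  for `n ≥ 2` as `(n-1)((n-2)2^{n-3} + 1)`, the existence half of the named fact
  `JerrumSnir1982_hamiltonianCircuit` (`MonotoneGapHamiltonian.lean`).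

This is the second seat's (orderings-based) rendering of the upper bound; the sibling
`MonotoneGapHamiltonianUpper.lean` (permutation-insertion rendering, used by
`MonotoneGapHamiltonianProofs.lean`) landed concurrently, and the declaration names of this file are
kept disjoint from it (`seqPathPoly`, `PathState`, `closeCycle`, `hcPoly_eq_sum_seqPathPoly`,
`sum_Ico_choose_mul_mul_sub_one`, `exists_isMonotoneComputation_hcPoly_of_two_le`) so that both
modules can be imported together (`Literature.lean`).
-/

noncomputable section

namespace Literature.Barriers.ValiantsHypothesis

namespace JerrumSnir

open Literature.Computability.AlgebraicComplexity MvPolynomial Finset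
open ArithCircuit (Gate Operand gateValues)
open scoped NNReal

/-! ### Sequences: two `Fin` tuple facts -/

section Tuples

variable {α : Type*} [DecidableEq α] {r : ℕ}

/-- The vertex set of a path minus its last vertex: for injective `v : Fin (r+2) → α`,
`image (Fin.init v) = image v ∖ {v (last)}`. [folklore] -/
theorem image_init_eq {v : Fin (r + 2) → α} (hv : Function.Injective v) :
    Finset.univ.image (Fin.init v) = (Finset.univ.image v).erase (v (Fin.last (r + 1))) := by
  ext x
  simp only [Finset.mem_image, Finset.mem_univ, true_and, Finset.mem_erase]
  constructor
  · rintro ⟨t, rfl⟩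
    refine ⟨fun h => ?_, ⟨t.castSucc, rfl⟩⟩
    exact (Fin.castSucc_lt_last t).ne (hv h)
  · rintro ⟨hne, s, rfl⟩
    have hs : s ≠ Fin.last (r + 1) := fun h => hne (by rw [h])
    obtain ⟨t, rfl⟩ := Fin.exists_castSucc_eq.2 hs
    exact ⟨t, rfl⟩

/-- The vertex set of an extended path: `image (Fin.snoc v x) = insert x (image v)`. [folklore] -/
theorem image_snoc_eq (v : Fin (r + 1) → α) (x : α) :
    Finset.univ.image (Fin.snoc v x : Fin (r + 2) → α) = insert x (Finset.univ.image v) := by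
  ext y
  simp only [Finset.mem_image, Finset.mem_univ, true_and, Finset.mem_insert]
  constructor
  · rintro ⟨i, rfl⟩
    rcases Fin.eq_castSucc_or_eq_last i with ⟨t, rfl⟩ | rfl
    · exact Or.inr ⟨t, by rw [Fin.snoc_castSucc]⟩
    · exact Or.inl (by rw [Fin.snoc_last])
  · rintro (rfl | ⟨t, rfl⟩)
    · exact ⟨Fin.last (r + 1), by rw [Fin.snoc_last]⟩
    · exact ⟨t.castSucc, by rw [Fin.snoc_castSucc]⟩

/-- Extending an injective sequence by a new value keeps it injective. [folklore] -/
theorem snoc_injective_of {v : Fin (r + 1) → α} (hv : Function.Injective v) {x : α}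
    (hx : x ∉ Finset.univ.image v) : Function.Injective (Fin.snoc v x : Fin (r + 2) → α) := by
  intro a b hab
  rcases Fin.eq_castSucc_or_eq_last a with ⟨s, rfl⟩ | rfl <;>
    rcases Fin.eq_castSucc_or_eq_last b with ⟨t, rfl⟩ | rfl
  · rw [Fin.snoc_castSucc, Fin.snoc_castSucc] at hab
    rw [hv hab]
  · rw [Fin.snoc_castSucc, Fin.snoc_last] at hab
    exact absurd (Finset.mem_image.2 ⟨s, Finset.mem_univ _, hab⟩) hx
  · rw [Fin.snoc_last, Fin.snoc_castSucc] at hab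
    exact absurd (Finset.mem_image.2 ⟨t, Finset.mem_univ _, hab.symm⟩) hx
  · rfl

end Tuples

/-! ### Path polynomials (JS p. 890) -/

section PathPoly

variable {m : ℕ}

/-- The monomial of the path `v 0 → v 1 → ⋯ → v r`: `Π_{t < r} X_{v(t+1), v(t)}` (the tree's
variable `X (a, b)` standing for the arc `b → a`, as in `hcPoly = Σ_σ Π_i X_{σ i, i}`).
[cite: JerrumSnir1982, §4.4 (p. 890)] -/
def pathMon (r : ℕ) (v : Fin (r + 1) → Fin (m + 2)) : MvPolynomial (Fin (m + 2) × Fin (m + 2)) ℝ≥0 :=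
  ∏ t : Fin r, X (v t.succ, v t.castSucc)

/-- The Hamiltonian paths of `{0} ∪ S` from `0` to `j`, as injective vertex sequences
`v : Fin (r+1) → Fin n` with `v 0 = 0`, vertex set `{0} ∪ S` and last vertex `j` (JS's paths
"which start at node `i`, end at node `j`, and pass through all the nodes in `I`", with the start
pinned at the vertex `0`). [cite: JerrumSnir1982, §4.4 (p. 890)] -/
def pathSeqs (r : ℕ) (S : Finset (Fin (m + 2))) (j : Fin (m + 2)) :
    Finset (Fin (r + 1) → Fin (m + 2)) :=
  Finset.univ.filter fun v => v 0 = 0 ∧ Function.Injective v ∧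
    Finset.univ.image v = insert 0 S ∧ v (Fin.last r) = j

/-- **JS's path polynomial** `p_{S,0,j}`: the sum of the monomials of the Hamiltonian paths of
`{0} ∪ S` from `0` to `j`. [cite: JerrumSnir1982, §4.4 (p. 890)] -/
def seqPathPoly (r : ℕ) (S : Finset (Fin (m + 2))) (j : Fin (m + 2)) :
    MvPolynomial (Fin (m + 2) × Fin (m + 2)) ℝ≥0 :=
  ∑ v ∈ pathSeqs r S j, pathMon r v

/-- Membership in `pathSeqs`. [folklore] -/
theorem mem_pathSeqs {r : ℕ} {S : Finset (Fin (m + 2))} {j : Fin (m + 2)}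
    {v : Fin (r + 1) → Fin (m + 2)} :
    v ∈ pathSeqs r S j ↔ v 0 = 0 ∧ Function.Injective v ∧
      Finset.univ.image v = insert 0 S ∧ v (Fin.last r) = j := by
  simp [pathSeqs]

/-- Peeling off the last arc of a path monomial. [cite: JerrumSnir1982, §4.4 (p. 890)] -/
theorem pathMon_succ (r : ℕ) (v : Fin (r + 2) → Fin (m + 2)) :
    pathMon (r + 1) v = pathMon r (Fin.init v) * X (v (Fin.last (r + 1)), v (Fin.last r).castSucc) := by
  unfold pathMon
  rw [Fin.prod_univ_castSucc, Fin.succ_last]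
  rfl

/-- **The dynamic programming recurrence** ("`p_{I,i,j} = Σ_l p_{I∖{i},l,j} x_{il}`", here with
the start pinned and the last arc peeled off): for `j ∈ S`, `j ≠ 0`, `r ≥ 1`,
`seqPathPoly (r+1) S j = Σ_{l ∈ S ∖ j} X_{j,l} · seqPathPoly r (S ∖ j) l`.
[cite: JerrumSnir1982, §4.4 (p. 890)] -/
theorem seqPathPoly_succ {r : ℕ} (hr : 1 ≤ r) {S : Finset (Fin (m + 2))} {j : Fin (m + 2)}
    (hj : j ∈ S) (hj0 : j ≠ 0) :
    seqPathPoly (r + 1) S j = ∑ l ∈ S.erase j, X (j, l) * seqPathPoly r (S.erase j) l := by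
  -- all paths of `{0} ∪ (S ∖ j)` from `0`, any last vertex
  set T : Finset (Fin (r + 1) → Fin (m + 2)) := Finset.univ.filter fun v =>
    v 0 = 0 ∧ Function.Injective v ∧ Finset.univ.image v = insert 0 (S.erase j) with hT
  have hmemT : ∀ {v : Fin (r + 1) → Fin (m + 2)}, v ∈ T ↔
      v 0 = 0 ∧ Function.Injective v ∧ Finset.univ.image v = insert 0 (S.erase j) := by
    intro v
    simp [hT]
  -- step 1: `v ↦ Fin.init v` is a bijection `pathSeqs (r+1) S j ≃ T`
  have h1 : seqPathPoly (r + 1) S j =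
      ∑ v ∈ T, pathMon r v * X (j, v (Fin.last r)) := by
    unfold seqPathPoly
    refine Finset.sum_nbij' Fin.init
      (fun v : Fin (r + 1) → Fin (m + 2) => (Fin.snoc (α := fun _ => Fin (m + 2)) v j))
      ?_ ?_ ?_ ?_ ?_
    · intro v hv
      obtain ⟨h0, hinj, himg, hlast⟩ := mem_pathSeqs.1 hv
      refine hmemT.2 ⟨?_, hinj.comp (Fin.castSucc_injective _), ?_⟩
      · show v (Fin.castSucc 0) = 0
        rw [Fin.castSucc_zero]
        exact h0
      · rw [image_init_eq hinj, himg, hlast, Finset.erase_insert_of_ne hj0.symm]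
    · intro v hv
      obtain ⟨h0, hinj, himg⟩ := hmemT.1 hv
      refine mem_pathSeqs.2 ⟨?_, ?_, ?_, ?_⟩
      · show Fin.snoc (α := fun _ => Fin (m + 2)) v j (Fin.castSucc 0) = 0
        rw [Fin.snoc_castSucc]
        exact h0
      · refine snoc_injective_of hinj ?_
        rw [himg, Finset.mem_insert, not_or]
        exact ⟨hj0, Finset.notMem_erase j S⟩
      · rw [image_snoc_eq, himg, Finset.insert_comm, Finset.insert_erase hj]
      · exact Fin.snoc_last _ _
    · intro v hv
      obtain ⟨-, -, -, hlast⟩ := mem_pathSeqs.1 hv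
      conv_rhs => rw [← Fin.snoc_init_self v]
      rw [hlast]
    · intro v _
      exact Fin.init_snoc _ _
    · intro v hv
      obtain ⟨-, -, -, hlast⟩ := mem_pathSeqs.1 hv
      rw [pathMon_succ, hlast]
      rfl
  -- step 2: split `T` by the last vertex `l ∈ S ∖ j`
  have hmaps : ∀ v ∈ T, v (Fin.last r) ∈ S.erase j := by
    intro v hv
    obtain ⟨h0, hinj, himg⟩ := hmemT.1 hv
    have hmem : v (Fin.last r) ∈ insert 0 (S.erase j) := by
      rw [← himg]
      exact Finset.mem_image_of_mem v (Finset.mem_univ _)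
    rcases Finset.mem_insert.1 hmem with h | h
    · exfalso
      have : Fin.last r = 0 := hinj (h.trans h0.symm)
      have h' := congrArg Fin.val this
      simp at h'
      omega
    · exact h
  have hfib : ∀ l ∈ S.erase j, T.filter (fun v => v (Fin.last r) = l) = pathSeqs r (S.erase j) l := by
    intro l _
    ext v
    simp only [hT, pathSeqs, Finset.mem_filter, Finset.mem_univ, true_and, and_assoc]
  rw [h1, ← Finset.sum_fiberwise_of_maps_to hmaps]
  refine Finset.sum_congr rfl fun l hl => ?_
  rw [hfib l hl, seqPathPoly, Finset.mul_sum]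
  refine Finset.sum_congr rfl fun v hv => ?_
  obtain ⟨-, -, -, hlast⟩ := mem_pathSeqs.1 hv
  rw [hlast, mul_comm]

/-- **The base of the dynamic programme**: a single arc, `seqPathPoly 1 {j} j = X_{j,0}` for `j ≠ 0`
("`p_{{i},i,j} = x_{ij}`"). [cite: JerrumSnir1982, §4.4 (p. 890)] -/
theorem seqPathPoly_one {j : Fin (m + 2)} (hj0 : j ≠ 0) : seqPathPoly 1 {j} j = X (j, 0) := by
  let v₀ : Fin 2 → Fin (m + 2) := ![0, j]
  have hseqs : pathSeqs 1 {j} j = {v₀} := by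
    refine Finset.eq_singleton_iff_unique_mem.2 ⟨?_, ?_⟩
    · refine mem_pathSeqs.2 ⟨rfl, ?_, ?_, rfl⟩
      · intro a b hab
        fin_cases a <;> fin_cases b
        · rfl
        · exact absurd hab.symm hj0
        · exact absurd hab hj0
        · rfl
      · ext x
        rw [Finset.mem_image, Finset.mem_insert, Finset.mem_singleton]
        constructor
        · rintro ⟨a, -, rfl⟩
          fin_cases a
          · exact Or.inl rfl
          · exact Or.inr rfl
        · rintro (rfl | rfl)
          · exact ⟨0, Finset.mem_univ _, rfl⟩
          · exact ⟨1, Finset.mem_univ _, rfl⟩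
    · intro v hv
      obtain ⟨h0, -, -, hlast⟩ := mem_pathSeqs.1 hv
      funext t
      fin_cases t
      · exact h0
      · exact hlast
  unfold seqPathPoly
  rw [hseqs, Finset.sum_singleton]
  unfold pathMon
  rw [Fin.prod_univ_one]
  rfl

/-- The cycle monomial of an ordering `σ` starting at `0`, split into its path from `0` to the
last vertex and the closing arc. [cite: JerrumSnir1982, §4.4 (p. 891, `HC = Σ_j p_{…,j} x_{j1}`)] -/
theorem prod_finRotate_eq (σ : Fin (m + 2) → Fin (m + 2)) (h0 : σ 0 = 0) :
    ∏ t : Fin (m + 2), (X (σ (finRotate (m + 2) t), σ t) : MvPolynomial _ ℝ≥0) =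
      pathMon (m + 1) σ * X (0, σ (Fin.last (m + 1))) := by
  rw [Fin.prod_univ_castSucc, finRotate_last, h0]
  unfold pathMon
  congr 1
  refine Finset.prod_congr rfl fun t _ => ?_
  rw [finRotate_apply, Fin.coeSucc_eq_succ]

/-- **The top identity**: `HC_n = Σ_{j ≠ 0} X_{0,j} · seqPathPoly (n-1) (univ ∖ 0) j` — a
Hamiltonian circuit is a Hamiltonian path from `0` to its last vertex `j` followed by the arc
`j → 0` ("`HC_{n×n} = Σ_{j=2}^{n} p_{{2,…,n}∖j, j} x_{j1}`"); via the tree's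
`hamiltonianCycleSum_eq_sum_orderings`. [cite: JerrumSnir1982, §4.4 (p. 891)] -/
theorem hcPoly_eq_sum_seqPathPoly (m : ℕ) :
    hcPoly (Fin (m + 2)) ℝ≥0 =
      ∑ j ∈ (Finset.univ : Finset (Fin (m + 2))).erase 0,
        X (0, j) * seqPathPoly (m + 1) (Finset.univ.erase 0) j := by
  -- all orderings starting at `0`, as injective sequences
  set T : Finset (Fin (m + 2) → Fin (m + 2)) := Finset.univ.filter fun v =>
    v 0 = 0 ∧ Function.Injective v with hT
  have hmemT : ∀ {v : Fin (m + 2) → Fin (m + 2)}, v ∈ T ↔ v 0 = 0 ∧ Function.Injective v := by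
    intro v
    simp [hT]
  have h1 : hcPoly (Fin (m + 2)) ℝ≥0 =
      ∑ v ∈ T, pathMon (m + 1) v * X (0, v (Fin.last (m + 1))) := by
    unfold hcPoly
    rw [hamiltonianCycleSum_eq_sum_orderings]
    simp only [Matrix.mvPolynomialX_apply]
    refine Finset.sum_nbij (fun σ : Equiv.Perm (Fin (m + 2)) => ⇑σ) ?_ ?_ ?_ ?_
    · intro σ hσ
      simp only [Finset.mem_filter, Finset.mem_univ, true_and] at hσ
      exact hmemT.2 ⟨hσ, σ.injective⟩
    · intro σ _ σ' _ h
      exact Equiv.ext (congrFun h)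
    · intro v hv
      obtain ⟨h0, hinj⟩ := hmemT.1 hv
      refine ⟨Equiv.ofBijective v (Finite.injective_iff_bijective.1 hinj), ?_, rfl⟩
      simp only [Finset.coe_filter, Finset.mem_univ, true_and, Set.mem_setOf_eq,
        Equiv.ofBijective_apply]
      exact h0
    · intro σ hσ
      simp only [Finset.mem_filter, Finset.mem_univ, true_and] at hσ
      exact prod_finRotate_eq σ hσ
  have hmaps : ∀ v ∈ T, v (Fin.last (m + 1)) ∈ (Finset.univ : Finset (Fin (m + 2))).erase 0 := by
    intro v hv
    obtain ⟨h0, hinj⟩ := hmemT.1 hv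
    rw [Finset.mem_erase]
    refine ⟨fun h => ?_, Finset.mem_univ _⟩
    have : Fin.last (m + 1) = 0 := hinj (h.trans h0.symm)
    have h' := congrArg Fin.val this
    simp at h'
  have hfib : ∀ j ∈ (Finset.univ : Finset (Fin (m + 2))).erase 0,
      T.filter (fun v => v (Fin.last (m + 1)) = j) = pathSeqs (m + 1) (Finset.univ.erase 0) j := by
    intro j _
    ext v
    simp only [hT, pathSeqs, Finset.mem_filter, Finset.mem_univ, true_and, and_assoc,
      Finset.insert_erase (Finset.mem_univ (0 : Fin (m + 2)))]
    constructor
    · rintro ⟨h0, hinj, hlast⟩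
      exact ⟨h0, hinj, Finset.image_univ_of_surjective (Finite.injective_iff_surjective.1 hinj),
        hlast⟩
    · rintro ⟨h0, hinj, -, hlast⟩
      exact ⟨h0, hinj, hlast⟩
  rw [h1, ← Finset.sum_fiberwise_of_maps_to hmaps]
  refine Finset.sum_congr rfl fun j hj => ?_
  rw [hfib j hj, seqPathPoly, Finset.mul_sum]
  refine Finset.sum_congr rfl fun v hv => ?_
  obtain ⟨-, -, -, hlast⟩ := mem_pathSeqs.1 hv
  rw [hlast, mul_comm]

end PathPoly

/-! ### The circuit of the dynamic programme -/

section Build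

variable {m : ℕ}

/-- The keys `(S, j)` of the dynamic programme. [cite: JerrumSnir1982, §4.4 (p. 890)] -/
abbrev HKey (m : ℕ) : Type := Σ _ : Finset (Fin (m + 2)), Fin (m + 2)

/-- A state of the construction: the gates emitted so far and, for every key `(S, j)`, an
operand (meaningful for the keys already processed). [cite: JerrumSnir1982, §4.4 (p. 890)] -/
structure PathState (m : ℕ) where
  /-- the gates emitted so far -/
  gs : List (Gate ℝ≥0 (Fin (m + 2) × Fin (m + 2)))
  /-- the operand holding the path polynomial of each processed key -/
  env : HKey m → Operand ℝ≥0 (Fin (m + 2) × Fin (m + 2))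

/-- Process one key `(S, j)`: emit `seqPathPoly |S| S j = Σ_{l ∈ S∖j} X_{j,l} · seqPathPoly (|S|-1) (S∖j) l`
from the operands of the keys `(S∖j, l)` and record the resulting operand.
[cite: JerrumSnir1982, §4.4 (p. 890)] -/
def processKey (st : PathState m) (k : HKey m) : PathState m :=
  ⟨(emitSumProd (fun l => (k.2, l)) (fun l => st.env ⟨k.1.erase k.2, l⟩) st.gs
      (k.1.erase k.2).toList).1,
    Function.update st.env k
      (emitSumProd (fun l => (k.2, l)) (fun l => st.env ⟨k.1.erase k.2, l⟩) st.gs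
        (k.1.erase k.2).toList).2⟩

/-- The keys of level `s`: `j ∈ S ⊆ univ ∖ 0`, `|S| = s`. [cite: JerrumSnir1982, §4.4 (p. 890)] -/
def levelKeys (m s : ℕ) : Finset (HKey m) :=
  (((Finset.univ : Finset (Fin (m + 2))).erase 0).powersetCard s).sigma fun S => S

/-- Process all keys of level `s`. [cite: JerrumSnir1982, §4.4 (p. 890)] -/
def processKeys (s : ℕ) (st : PathState m) : PathState m :=
  (levelKeys m s).toList.foldl processKey st

/-- Process the levels `s, s + 1, …, m + 1` in turn. [cite: JerrumSnir1982, §4.4 (p. 890)] -/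
def buildLevels : ℕ → PathState m → PathState m
  | s, st => if s ≤ m + 1 then buildLevels (s + 1) (processKeys s st) else st
  termination_by s => m + 2 - s

/-- The initial operands: the level-`1` path polynomials `seqPathPoly 1 {j} j = X_{j,0}` are variables
(no gates). [cite: JerrumSnir1982, §4.4 (p. 890, `p_{{i},i,j} = x_{ij}`)] -/
def initOps : HKey m → Operand ℝ≥0 (Fin (m + 2) × Fin (m + 2)) := fun k => .var (k.2, 0)

/-- The closing step: `HC = Σ_{j ≠ 0} X_{0,j} · seqPathPoly (m+1) (univ∖0) j`, `m + 1` more product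
gates. [cite: JerrumSnir1982, §4.4 (p. 891)] -/
def closeCycle (st : PathState m) :
    List (Gate ℝ≥0 (Fin (m + 2) × Fin (m + 2))) × Operand ℝ≥0 (Fin (m + 2) × Fin (m + 2)) :=
  emitSumProd (fun j => ((0 : Fin (m + 2)), j)) (fun j => st.env ⟨Finset.univ.erase 0, j⟩) st.gs
    ((Finset.univ : Finset (Fin (m + 2))).erase 0).toList

/-- **The Hamiltonian-path dynamic programme as a monotone computation** of `HC_{m+2}`.
[cite: JerrumSnir1982, §4.4 (pp. 890–891)] -/
def pathCircuit (m : ℕ) : ArithCircuit ℝ≥0 (Fin (m + 2) × Fin (m + 2)) where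
  gates := (closeCycle (buildLevels 2 (⟨[], initOps⟩ : PathState m))).1
  output := (closeCycle (buildLevels 2 (⟨[], initOps⟩ : PathState m))).2

/-- The invariant: the operands of the keys in `D` are valid and hold their path polynomials.
[cite: JerrumSnir1982, §4.4 (p. 890)] -/
def KGood (st : PathState m) (D : Set (HKey m)) : Prop :=
  ∀ k ∈ D, OpOK st.gs (st.env k) (seqPathPoly k.1.card k.1 k.2)

/-- The meaningful keys of level at most `s`: `j ∈ S`, `0 ∉ S`, `|S| ≤ s`. [folklore] -/
def keysLe (m s : ℕ) : Set (HKey m) := {k | (0 : Fin (m + 2)) ∉ k.1 ∧ k.2 ∈ k.1 ∧ k.1.card ≤ s}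

/-- Processing one key of level `s ≥ 2`. [cite: JerrumSnir1982, §4.4 (p. 890)] -/
theorem processKey_spec {st : PathState m} {D : Set (HKey m)} (hst : KGood st D)
    (hgs : GatesOK st.gs) {S : Finset (Fin (m + 2))} {j : Fin (m + 2)} {s : ℕ} (hs : 2 ≤ s)
    (hS : S.card = s) (h0 : (0 : Fin (m + 2)) ∉ S) (hj : j ∈ S)
    (hD : ∀ l ∈ S.erase j, (⟨S.erase j, l⟩ : HKey m) ∈ D) :
    KGood (processKey st ⟨S, j⟩) (insert ⟨S, j⟩ D) ∧ GatesOK (processKey st ⟨S, j⟩).gs ∧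
      st.gs <+: (processKey st ⟨S, j⟩).gs ∧
      ((processKey st ⟨S, j⟩).gs.countP fun g => isProdGate g) =
        (st.gs.countP fun g => isProdGate g) + (s - 1) := by
  have hj0 : j ≠ 0 := fun h => h0 (h ▸ hj)
  have hcard : (S.erase j).card = s - 1 := by rw [Finset.card_erase_of_mem hj, hS]
  have hl0 : (S.erase j).toList ≠ [] :=
    Finset.Nonempty.toList_ne_nil (Finset.card_pos.1 (by rw [hcard]; omega))
  have hl : ∀ l ∈ (S.erase j).toList,
      OpOK st.gs (st.env ⟨S.erase j, l⟩) (seqPathPoly (s - 1) (S.erase j) l) := by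
    intro l hl
    have h : OpOK st.gs (st.env ⟨S.erase j, l⟩) (seqPathPoly (S.erase j).card (S.erase j) l) :=
      hst _ (hD l (Finset.mem_toList.1 hl))
    rwa [hcard] at h
  obtain ⟨hpre, hok, hcount, hmem⟩ :=
    emitSumProd_spec (fun l => (j, l)) (fun l => st.env ⟨S.erase j, l⟩)
      (fun l => seqPathPoly (s - 1) (S.erase j) l) hl0 st.gs hl
  have hrec : ((S.erase j).toList.map fun l => X (j, l) * seqPathPoly (s - 1) (S.erase j) l).sum =
      seqPathPoly S.card S j := by
    rw [Finset.sum_map_toList, hS]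
    obtain ⟨s', rfl⟩ : ∃ s', s = s' + 1 := ⟨s - 1, by omega⟩
    rw [Nat.add_sub_cancel]
    exact (seqPathPoly_succ (by omega) hj hj0).symm
  rw [hrec] at hok
  refine ⟨?_, ?_, hpre, ?_⟩
  · intro k hk
    show OpOK _ (Function.update st.env ⟨S, j⟩ _ k) _
    by_cases hkS : k = ⟨S, j⟩
    · subst hkS
      rw [Function.update_self]
      exact hok
    · rw [Function.update_of_ne hkS]
      rcases hk with rfl | hk
      · exact absurd rfl hkS
      · exact (hst k hk).of_prefix hpre
  · intro g hg
    rcases hmem g hg with hg | hg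
    · exact hgs g hg
    · exact hg
  · change List.countP (fun g => isProdGate g)
        (emitSumProd (fun l => (j, l)) (fun l => st.env ⟨S.erase j, l⟩) st.gs
          (S.erase j).toList).1 = _
    rw [hcount, Finset.length_toList, hcard]

/-- Processing a list of keys of level `s` over a state good for the levels `< s`.
[cite: JerrumSnir1982, §4.4 (p. 890)] -/
theorem foldl_processKey_spec {s : ℕ} (hs : 2 ≤ s) :
    ∀ (l : List (HKey m)) (st : PathState m) (D : Set (HKey m)),
      keysLe m (s - 1) ⊆ D → KGood st D → GatesOK st.gs →
        (∀ k ∈ l, (0 : Fin (m + 2)) ∉ k.1 ∧ k.2 ∈ k.1 ∧ k.1.card = s) →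
        KGood (l.foldl processKey st) (D ∪ {k | k ∈ l}) ∧
        GatesOK (l.foldl processKey st).gs ∧
        st.gs <+: (l.foldl processKey st).gs ∧
        ((l.foldl processKey st).gs.countP fun g => isProdGate g) =
          (st.gs.countP fun g => isProdGate g) + l.length * (s - 1)
  | [], st, D, _, hst, hgs, _ => by
    refine ⟨fun k hk => ?_, hgs, List.prefix_rfl, by simp⟩
    rcases hk with hk | hk
    · exact hst k hk
    · simp at hk
  | ⟨S, j⟩ :: rest, st, D, hD, hst, hgs, hl => by
    obtain ⟨h0, hj, hS⟩ := hl ⟨S, j⟩ List.mem_cons_self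
    have hDS : ∀ l ∈ S.erase j, (⟨S.erase j, l⟩ : HKey m) ∈ D := by
      intro l hl
      apply hD
      refine ⟨fun h => h0 (Finset.mem_of_mem_erase h), hl, ?_⟩
      show (S.erase j).card ≤ s - 1
      rw [Finset.card_erase_of_mem hj, hS]
    obtain ⟨h1, h2, h3, h4⟩ := processKey_spec hst hgs hs hS h0 hj hDS
    obtain ⟨h1', h2', h3', h4'⟩ := foldl_processKey_spec hs rest (processKey st ⟨S, j⟩)
      (insert ⟨S, j⟩ D) (hD.trans (Set.subset_insert _ _)) h1 h2
      (fun k' hk' => hl k' (List.mem_cons_of_mem _ hk'))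
    rw [List.foldl_cons]
    refine ⟨fun k' hk' => h1' k' ?_, h2', h3.trans h3', ?_⟩
    · rcases hk' with hk' | hk'
      · exact Or.inl (Set.mem_insert_of_mem _ hk')
      · simp only [Set.mem_setOf_eq, List.mem_cons] at hk'
        rcases hk' with rfl | hk'
        · exact Or.inl (Set.mem_insert _ _)
        · exact Or.inr hk'
    · rw [h4', h4, List.length_cons]
      ring

/-- Membership in `levelKeys`. [folklore] -/
theorem mem_levelKeys {s : ℕ} {k : HKey m} :
    k ∈ levelKeys m s ↔ (0 : Fin (m + 2)) ∉ k.1 ∧ k.2 ∈ k.1 ∧ k.1.card = s := by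
  obtain ⟨S, j⟩ := k
  simp only [levelKeys, Finset.mem_sigma, Finset.mem_powersetCard]
  constructor
  · rintro ⟨⟨hsub, hcard⟩, hj⟩
    exact ⟨fun h => by simpa using hsub h, hj, hcard⟩
  · rintro ⟨h0, hj, hcard⟩
    refine ⟨⟨fun x hx => Finset.mem_erase.2 ⟨fun h => h0 (h ▸ hx), Finset.mem_univ _⟩, hcard⟩, hj⟩

/-- The number of keys of level `s`: `Σ_{|S| = s} |S| = s · C(m+1, s)`.
[cite: JerrumSnir1982, §4.4 (p. 891, `r (n-1) C(n-2, r)`)] -/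
theorem card_levelKeys (m s : ℕ) : (levelKeys m s).card = (m + 1).choose s * s := by
  unfold levelKeys
  rw [Finset.card_sigma]
  have h : ∀ S ∈ ((Finset.univ : Finset (Fin (m + 2))).erase 0).powersetCard s, S.card = s :=
    fun S hS => (Finset.mem_powersetCard.1 hS).2
  rw [Finset.sum_congr rfl h, Finset.sum_const, Finset.card_powersetCard, smul_eq_mul,
    Finset.card_erase_of_mem (Finset.mem_univ _), Finset.card_univ, Fintype.card_fin,
    show m + 2 - 1 = m + 1 by omega]

/-- Processing one level. [cite: JerrumSnir1982, §4.4 (p. 891)] -/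
theorem processKeys_spec {s : ℕ} (hs : 2 ≤ s) (st : PathState m)
    (hst : KGood st (keysLe m (s - 1))) (hgs : GatesOK st.gs) :
    KGood (processKeys s st) (keysLe m s) ∧ GatesOK (processKeys s st).gs ∧
      st.gs <+: (processKeys s st).gs ∧
      ((processKeys s st).gs.countP fun g => isProdGate g) =
        (st.gs.countP fun g => isProdGate g) + (levelKeys m s).card * (s - 1) := by
  obtain ⟨h1, h2, h3, h4⟩ := foldl_processKey_spec hs (levelKeys m s).toList st
    (keysLe m (s - 1)) le_rfl hst hgs (fun k hk => mem_levelKeys.1 (Finset.mem_toList.1 hk))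
  refine ⟨fun k ⟨hk0, hkj, hks⟩ => h1 k ?_, h2, h3, ?_⟩
  · rcases Nat.lt_or_ge k.1.card s with hlt | hge
    · exact Or.inl ⟨hk0, hkj, by omega⟩
    · refine Or.inr ?_
      simp only [Set.mem_setOf_eq, Finset.mem_toList]
      exact mem_levelKeys.2 ⟨hk0, hkj, by omega⟩
  · change List.countP (fun g => isProdGate g)
        (List.foldl processKey st (levelKeys m s).toList).gs = _
    rw [h4, Finset.length_toList]

/-- Processing all remaining levels. [cite: JerrumSnir1982, §4.4 (p. 891)] -/
theorem buildLevels_spec (s : ℕ) (hs : 2 ≤ s) (st : PathState m) (hst : KGood st (keysLe m (s - 1)))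
    (hgs : GatesOK st.gs) :
    KGood (buildLevels s st) (keysLe m (m + 1)) ∧ GatesOK (buildLevels s st).gs ∧
      ((buildLevels s st).gs.countP fun g => isProdGate g) =
        (st.gs.countP fun g => isProdGate g) +
          ∑ i ∈ Finset.Ico s (m + 2), (levelKeys m i).card * (i - 1) := by
  rw [buildLevels]
  split_ifs with h
  · obtain ⟨h1, h2, -, h4⟩ := processKeys_spec hs st hst hgs
    have h1' : KGood (processKeys s st) (keysLe m (s + 1 - 1)) := by
      rw [Nat.add_sub_cancel]; exact h1
    obtain ⟨h1'', h2', h4'⟩ := buildLevels_spec (s + 1) (by omega) _ h1' h2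
    refine ⟨h1'', h2', ?_⟩
    rw [h4', h4, Finset.sum_eq_sum_Ico_succ_bot (show s < m + 2 by omega)]
    ring
  · refine ⟨fun k ⟨hk0, hkj, hks⟩ => hst k ⟨hk0, hkj, ?_⟩, hgs, ?_⟩
    · have h1 := Finset.card_le_card (show k.1 ⊆ Finset.univ.erase 0 from fun x hx =>
        Finset.mem_erase.2 ⟨fun h => hk0 (h ▸ hx), Finset.mem_univ _⟩)
      rw [Finset.card_erase_of_mem (Finset.mem_univ _), Finset.card_univ, Fintype.card_fin] at h1
      omega
    · rw [Finset.Ico_eq_empty (by omega), Finset.sum_empty, add_zero]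
termination_by m + 2 - s

/-- The initial state is good for the level-`1` keys: `seqPathPoly 1 {j} j = X_{j,0}` is the
variable operand. [cite: JerrumSnir1982, §4.4 (p. 890, `p_{{i},i,j} = x_{ij}`)] -/
theorem kgood_init : KGood (⟨[], initOps⟩ : PathState m) (keysLe m 1) := by
  rintro ⟨S, j⟩ ⟨h0, hj, hS⟩
  dsimp only at h0 hj hS
  have hS1 : S.card = 1 := le_antisymm hS (Finset.card_pos.2 ⟨j, hj⟩)
  obtain ⟨i, hi⟩ := Finset.card_eq_one.1 hS1
  have hSj : S = {j} := by
    have hj' := hj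
    rw [hi, Finset.mem_singleton] at hj'
    rw [hi, hj']
  have hj0 : j ≠ 0 := fun h => h0 (h ▸ hj)
  show OpOK [] (Operand.var (j, 0)) (seqPathPoly S.card S j)
  rw [hSj, Finset.card_singleton]
  exact (seqPathPoly_one hj0).symm

/-- `Σ_{s=2}^{m+1} s (s-1) C(m+1, s) = (m+1) m 2^{m-1}` (JS: level `r` costs
`r (n-1) C(n-2, r)` multiplications, "`= (n-1)(n-2) 2^{(n-3)}`" in total, `n = m + 2`).
[cite: JerrumSnir1982, §4.4 (p. 891)] -/
theorem sum_Ico_choose_mul_mul_sub_one (m : ℕ) :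
    ∑ i ∈ Finset.Ico 2 (m + 2), (m + 1).choose i * i * (i - 1) = (m + 1) * m * 2 ^ (m - 1) := by
  rcases Nat.eq_zero_or_pos m with rfl | hm
  · simp
  · obtain ⟨K, rfl⟩ : ∃ K, m = K + 1 := ⟨m - 1, by omega⟩
    rw [Nat.add_sub_cancel]
    have hterm : ∀ i ∈ Finset.Ico 2 (K + 1 + 2),
        (K + 1 + 1).choose i * i * (i - 1) = (K + 1 + 1) * (K + 1) * K.choose (i - 2) := by
      intro i hi
      rw [Finset.mem_Ico] at hi
      obtain ⟨a, rfl⟩ : ∃ a, i = a + 1 + 1 := ⟨i - 2, by omega⟩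
      have h1 := Nat.add_one_mul_choose_eq (K + 1) (a + 1)
      have h2 := Nat.add_one_mul_choose_eq K a
      rw [show a + 1 + 1 - 1 = a + 1 by omega, show a + 1 + 1 - 2 = a by omega]
      calc (K + 1 + 1).choose (a + 1 + 1) * (a + 1 + 1) * (a + 1)
          = ((K + 1 + 1) * (K + 1).choose (a + 1)) * (a + 1) := by rw [h1]
        _ = (K + 1 + 1) * ((K + 1).choose (a + 1) * (a + 1)) := by ring
        _ = (K + 1 + 1) * ((K + 1) * K.choose a) := by rw [h2]
        _ = (K + 1 + 1) * (K + 1) * K.choose a := by ring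
    rw [Finset.sum_congr rfl hterm, ← Finset.mul_sum]
    congr 1
    rw [Finset.sum_Ico_eq_sum_range, show K + 1 + 2 - 2 = K + 1 by omega, ← Nat.sum_range_choose K]
    refine Finset.sum_congr rfl fun k _ => ?_
    rw [Nat.add_sub_cancel_left]

/-- **Jerrum–Snir 1982, §4.4 — the upper bound: the Hamiltonian-path dynamic programme is a
monotone computation of `HC_{m+2}` with exactly `(m+1)(m 2^{m-1} + 1)` product gates**
("so it can be computed in `(n-1)(n-2)2^{(n-3)} + (n-1)` multiplications", `n = m + 2`).
[cite: JerrumSnir1982, §4.4 (pp. 890–891)] -/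
theorem pathCircuit_spec (m : ℕ) :
    IsMonotoneComputation (pathCircuit m) (hcPoly (Fin (m + 2)) ℝ≥0) ∧
      prodCount (pathCircuit m) = (m + 1) * (m * 2 ^ (m - 1) + 1) := by
  obtain ⟨hgood, hgates, hcount⟩ :=
    buildLevels_spec 2 le_rfl (⟨[], initOps⟩ : PathState m) kgood_init (fun g hg => by simp at hg)
  set st := buildLevels 2 (⟨[], initOps⟩ : PathState m) with hst
  have hU : ((Finset.univ : Finset (Fin (m + 2))).erase 0).card = m + 1 := by
    rw [Finset.card_erase_of_mem (Finset.mem_univ _), Finset.card_univ, Fintype.card_fin]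
    omega
  have hl0 : ((Finset.univ : Finset (Fin (m + 2))).erase 0).toList ≠ [] :=
    Finset.Nonempty.toList_ne_nil (Finset.card_pos.1 (by rw [hU]; omega))
  have hl : ∀ j ∈ ((Finset.univ : Finset (Fin (m + 2))).erase 0).toList,
      OpOK st.gs (st.env ⟨Finset.univ.erase 0, j⟩) (seqPathPoly (m + 1) (Finset.univ.erase 0) j) := by
    intro j hj
    rw [Finset.mem_toList] at hj
    have h : OpOK st.gs (st.env ⟨Finset.univ.erase 0, j⟩)
        (seqPathPoly ((Finset.univ : Finset (Fin (m + 2))).erase 0).card (Finset.univ.erase 0) j) :=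
      hgood ⟨Finset.univ.erase 0, j⟩ ⟨Finset.notMem_erase _ _, hj, hU.le⟩
    rwa [hU] at h
  obtain ⟨-, hok, hcount', hmem⟩ :=
    emitSumProd_spec (fun j => ((0 : Fin (m + 2)), j)) (fun j => st.env ⟨Finset.univ.erase 0, j⟩)
      (fun j => seqPathPoly (m + 1) (Finset.univ.erase 0) j) hl0 st.gs hl
  rw [Finset.sum_map_toList, ← hcPoly_eq_sum_seqPathPoly] at hok
  refine ⟨⟨fun g hg => ?_, fun g hg => ?_, ?_⟩, ?_⟩
  · rcases hmem g hg with hg | hg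
    · exact (hgates g hg).1.le
    · exact hg.1.le
  · rcases hmem g hg with hg | hg
    · exact (hgates g hg).2
    · exact hg.2
  · show (pathCircuit m).eval = hcPoly (Fin (m + 2)) ℝ≥0
    rw [eval_eq_opVal]
    exact hok.opVal_eq List.prefix_rfl le_rfl
  · show List.countP _ (closeCycle st).1 = _
    unfold closeCycle
    rw [hcount', hcount, Finset.length_toList, hU]
    have hterm : ∀ i ∈ Finset.Ico 2 (m + 2), (levelKeys m i).card * (i - 1) =
        (m + 1).choose i * i * (i - 1) := fun i _ => by rw [card_levelKeys]
    rw [Finset.sum_congr rfl hterm, sum_Ico_choose_mul_mul_sub_one]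
    simp only [List.countP_nil, zero_add]
    ring

/-- **Jerrum–Snir 1982, §4.4, upper bound** restated for `n ≥ 2`: a monotone computation of
`HC_{n×n}` with exactly `(n-1)((n-2) 2^{n-3} + 1)` product gates exists ("so it can be computed in
`(n-1)(n-2)2^{(n-3)} + (n-1)` multiplications"). [cite: JerrumSnir1982, §4.4 (pp. 890–891)] -/
theorem exists_isMonotoneComputation_hcPoly_of_two_le {n : ℕ} (hn : 2 ≤ n) :
    ∃ P : ArithCircuit ℝ≥0 (Fin n × Fin n), IsMonotoneComputation P (hcPoly (Fin n) ℝ≥0) ∧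
      prodCount P = (n - 1) * ((n - 2) * 2 ^ (n - 3) + 1) := by
  obtain ⟨m, rfl⟩ : ∃ m, n = m + 2 := ⟨n - 2, by omega⟩
  refine ⟨pathCircuit m, (pathCircuit_spec m).1, ?_⟩
  rw [(pathCircuit_spec m).2, Nat.add_sub_cancel, show m + 2 - 1 = m + 1 by omega,
    show m + 2 - 3 = m - 1 by omega]

end Build

end JerrumSnir

end Literature.Barriers.ValiantsHypothesis
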